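import Mathlib
import Literature.NumberTheory.Sieve.RoughOmegaCells
import HarnessLib

/-!
# Route ParityLeakOneFifth, crux `PlainSplit` (stmt-Parity-18382), skeleton `calib-split`:
# tools for stub `stub_calibReduction`, I — the truncated Möbius sum on a rough squarefree integer

For a squarefree `m` all of whose prime factors are `≥ y` and a level `D < y³`, the truncated
Möbius sum `G(m) = Σ_{d ∣ m, d ≤ D} μ(d)` equals `1 − s₁(m) + s₂(m)` with `s₁ = #{p ∣ m prime, p ≤ D}`,
`s₂ = #{d ∣ m, Ω(d) = 2, d ≤ D}` (divisors `d ≤ D` have `Ω(d) ≤ 2`).  Consequences used by the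
pointwise inequality of `stub_calibReduction` (file `…CalibReduction2.lean`):
`Ω(m) = 3 ⇒ G ≥ −2`; `Ω(m) = 2`, `m > D²` ⇒ `G = 1 − [minFac m ≤ D]`; `Ω(m) = 1`, `m > D` ⇒ `G = 1`;
`Ω(m) = 4`, all `p ∣ m` with `p ≤ D`, `m > D²` ⇒ `G ≤ 0` (the involution `d ↦ m/d` on the six semiprime
divisors sends `{d ≤ D}` into `{d > D}`); `Ω(m) = 5` with all semiprime divisors `≤ D` ⇒ `G = 6`.
-/

namespace Summit.Parity.GeneralizedHardyLittlewood.Theorems.ParityLeakOneFifth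

open Finset
open scoped ArithmeticFunction.Omega ArithmeticFunction.Moebius
open Literature.NumberTheory.Sieve

/-- A squarefree `d` with all prime factors `≥ N` satisfies `N ^ Ω(d) ≤ d` (indeed for any `d ≥ 1`). -/
theorem pow_cardFactors_le_of_rough {N d : ℕ} (hd : d ≠ 0)
    (hr : ∀ p : ℕ, p.Prime → p ∣ d → N ≤ p) : N ^ Ω d ≤ d :=
  pow_cardFactors_le_of_mem_roughIcc (X := d)
    (mem_roughIcc.2 ⟨⟨Nat.one_le_iff_ne_zero.2 hd, le_rfl⟩, hr⟩)

/-- Divisors of a `y`-rough number are `y`-rough. -/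
theorem rough_of_dvd {m d : ℕ} {y : ℝ} (hm : ∀ p ∈ m.primeFactors, y ≤ (p : ℝ)) (hm0 : m ≠ 0)
    (hd : d ∣ m) : ∀ p ∈ d.primeFactors, y ≤ (p : ℝ) := by
  intro p hp
  obtain ⟨hpr, hpd, -⟩ := Nat.mem_primeFactors.1 hp
  exact hm p (Nat.mem_primeFactors.2 ⟨hpr, hpd.trans hd, hm0⟩)

/-- For a `y`-rough `m`, the roughness condition in the truncated Möbius sum is automatic. -/
theorem filter_divisors_rough_eq {m : ℕ} {y D : ℝ} (hm : ∀ p ∈ m.primeFactors, y ≤ (p : ℝ))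
    (hm0 : m ≠ 0) :
    (Nat.divisors m).filter (fun d : ℕ => (d : ℝ) ≤ D ∧ ∀ p ∈ d.primeFactors, y ≤ (p : ℝ)) =
      (Nat.divisors m).filter (fun d : ℕ => (d : ℝ) ≤ D) := by
  refine Finset.filter_congr fun d hd => ?_
  exact ⟨fun h => h.1, fun h => ⟨h, rough_of_dvd hm hm0 (Nat.dvd_of_mem_divisors hd)⟩⟩

/-- A `y`-rough `d ≠ 0` with `d ≤ D < y³` (`y ≥ 1`) has `Ω(d) ≤ 2`. -/
theorem cardFactors_le_two_of_le {d : ℕ} {y D : ℝ} (hy : 1 ≤ y) (hD : D < y ^ 3) (hd0 : d ≠ 0)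
    (hr : ∀ p ∈ d.primeFactors, y ≤ (p : ℝ)) (hdD : (d : ℝ) ≤ D) : Ω d ≤ 2 := by
  by_contra h
  have h3 : 3 ≤ Ω d := by omega
  -- `⌈y⌉ ^ Ω d ≤ d`
  have hN : ∀ p : ℕ, p.Prime → p ∣ d → ⌈y⌉₊ ≤ p := fun p hp hpd =>
    Nat.ceil_le.2 (hr p (Nat.mem_primeFactors.2 ⟨hp, hpd, hd0⟩))
  have h1 := pow_cardFactors_le_of_rough hd0 hN
  have h2 : (y : ℝ) ^ 3 ≤ (⌈y⌉₊ : ℝ) ^ Ω d := by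
    calc (y : ℝ) ^ 3 ≤ y ^ Ω d := pow_le_pow_right₀ hy h3
      _ ≤ (⌈y⌉₊ : ℝ) ^ Ω d := pow_le_pow_left₀ (by linarith) (Nat.le_ceil y) _
  have h1' : ((⌈y⌉₊ : ℝ)) ^ Ω d ≤ (d : ℝ) := by exact_mod_cast h1
  linarith

/-- **`G(m) = 1 − s₁ + s₂`** for squarefree `y`-rough `m` and `D < y³` (`y ≥ 1`). -/
theorem truncMoebius_eq {m : ℕ} {y D : ℝ} (hy : 1 ≤ y) (hD : D < y ^ 3) (hD1 : 1 ≤ D)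
    (hm : Squarefree m) (hr : ∀ p ∈ m.primeFactors, y ≤ (p : ℝ)) :
    ∑ d ∈ (Nat.divisors m).filter (fun d : ℕ => (d : ℝ) ≤ D), (μ d : ℝ) =
      1 - #((Nat.divisors m).filter (fun d : ℕ => d.Prime ∧ (d : ℝ) ≤ D)) +
        #((Nat.divisors m).filter (fun d : ℕ => Ω d = 2 ∧ (d : ℝ) ≤ D)) := by
  have hm0 : m ≠ 0 := hm.ne_zero
  -- `μ d = (-1)^Ω d` on the divisors, and `Ω d ∈ {0,1,2}`
  have hsplit : ∀ d ∈ (Nat.divisors m).filter (fun d : ℕ => (d : ℝ) ≤ D),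
      (μ d : ℝ) = (if Ω d = 0 then 1 else 0) - (if d.Prime ∧ (d : ℝ) ≤ D then 1 else 0) +
        (if Ω d = 2 ∧ (d : ℝ) ≤ D then 1 else 0) := by
    intro d hd
    rw [Finset.mem_filter] at hd
    have hdm := Nat.dvd_of_mem_divisors hd.1
    have hd0 : d ≠ 0 := Nat.pos_of_mem_divisors hd.1 |>.ne'
    have hsq : Squarefree d := hm.squarefree_of_dvd hdm
    have hΩ := cardFactors_le_two_of_le hy hD hd0 (rough_of_dvd hr hm0 hdm) hd.2
    rw [ArithmeticFunction.moebius_apply_of_squarefree hsq]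
    have hprime : d.Prime ↔ Ω d = 1 := ArithmeticFunction.cardFactors_eq_one_iff_prime.symm
    interval_cases hΩd : Ω d
    · simp [hprime, hd.2]
    · have : d.Prime := hprime.2 rfl
      simp [this, hd.2]
    · have : ¬ d.Prime := fun h => by have := hprime.1 h; omega
      simp [this, hd.2]
  rw [Finset.sum_congr rfl hsplit, Finset.sum_add_distrib, Finset.sum_sub_distrib]
  -- the three indicator sums
  have h0 : ∑ d ∈ (Nat.divisors m).filter (fun d : ℕ => (d : ℝ) ≤ D),
      (if Ω d = 0 then (1 : ℝ) else 0) = 1 := by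
    rw [Finset.sum_ite, Finset.sum_const_zero, add_zero, Finset.sum_const, nsmul_eq_mul, mul_one]
    have : ((Nat.divisors m).filter (fun d : ℕ => (d : ℝ) ≤ D)).filter (fun d => Ω d = 0) = {1} := by
      ext d
      simp only [Finset.mem_filter, Finset.mem_singleton, Nat.mem_divisors,
        ArithmeticFunction.cardFactors_eq_zero_iff_eq_zero_or_one]
      constructor
      · rintro ⟨⟨⟨hdm, -⟩, -⟩, (rfl | rfl)⟩
        · exact absurd (Nat.eq_zero_of_zero_dvd hdm) hm0
        · rfl
      · rintro rfl
        exact ⟨⟨⟨one_dvd m, hm0⟩, by exact_mod_cast hD1⟩, Or.inr rfl⟩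
    rw [this, Finset.card_singleton, Nat.cast_one]
  have h1 : ∑ d ∈ (Nat.divisors m).filter (fun d : ℕ => (d : ℝ) ≤ D),
      (if d.Prime ∧ (d : ℝ) ≤ D then (1 : ℝ) else 0) =
      #((Nat.divisors m).filter (fun d : ℕ => d.Prime ∧ (d : ℝ) ≤ D)) := by
    rw [Finset.sum_ite, Finset.sum_const_zero, add_zero, Finset.sum_const, nsmul_eq_mul, mul_one,
      Finset.filter_filter]
    congr 2
    ext d; simp only [Finset.mem_filter]; tauto
  have h2 : ∑ d ∈ (Nat.divisors m).filter (fun d : ℕ => (d : ℝ) ≤ D),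
      (if Ω d = 2 ∧ (d : ℝ) ≤ D then (1 : ℝ) else 0) =
      #((Nat.divisors m).filter (fun d : ℕ => Ω d = 2 ∧ (d : ℝ) ≤ D)) := by
    rw [Finset.sum_ite, Finset.sum_const_zero, add_zero, Finset.sum_const, nsmul_eq_mul, mul_one,
      Finset.filter_filter]
    congr 2
    ext d; simp only [Finset.mem_filter]; tauto
  rw [h0, h1, h2]


/-! ### `s₁` and `s₂` by the number of prime factors -/

/-- `#{d ∣ m prime, d ≤ D} = #{p ∈ primeFactors m : p ≤ D}`. -/
theorem card_filter_prime_divisors_eq (m : ℕ) (D : ℝ) :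
    #((Nat.divisors m).filter (fun d : ℕ => d.Prime ∧ (d : ℝ) ≤ D)) =
      #(m.primeFactors.filter (fun p : ℕ => (p : ℝ) ≤ D)) := by
  congr 1
  ext d
  simp only [Finset.mem_filter, Nat.mem_divisors, Nat.mem_primeFactors]
  tauto

/-- For squarefree `m`: `#primeFactors m = Ω m`. -/
theorem card_primeFactors_eq_cardFactors {m : ℕ} (hm : Squarefree m) :
    #m.primeFactors = Ω m := by
  rw [Nat.primeFactors, List.toFinset_card_of_nodup
    ((Nat.squarefree_iff_nodup_primeFactorsList hm.ne_zero).1 hm), ArithmeticFunction.cardFactors_apply]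

/-- `s₁ ≤ Ω m` for squarefree `m`. -/
theorem card_filter_prime_divisors_le {m : ℕ} (hm : Squarefree m) (D : ℝ) :
    #((Nat.divisors m).filter (fun d : ℕ => d.Prime ∧ (d : ℝ) ≤ D)) ≤ Ω m := by
  rw [card_filter_prime_divisors_eq m, ← card_primeFactors_eq_cardFactors hm]
  exact Finset.card_filter_le _ _

/-- `s₁ = Ω m` for squarefree `m` all of whose prime factors are `≤ D`. -/
theorem card_filter_prime_divisors_eq_cardFactors {m : ℕ} (hm : Squarefree m) {D : ℝ}
    (hall : ∀ p ∈ m.primeFactors, (p : ℝ) ≤ D) :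
    #((Nat.divisors m).filter (fun d : ℕ => d.Prime ∧ (d : ℝ) ≤ D)) = Ω m := by
  rw [card_filter_prime_divisors_eq m, ← card_primeFactors_eq_cardFactors hm,
    Finset.filter_true_of_mem hall]

/-- A divisor with the same number of prime factors is the number itself. -/
theorem eq_of_dvd_of_cardFactors_eq {d m : ℕ} (hm0 : m ≠ 0) (hd : d ∣ m) (hΩ : Ω d = Ω m) :
    d = m := by
  obtain ⟨k, rfl⟩ := hd
  have hd0 : d ≠ 0 := left_ne_zero_of_mul hm0
  have hk0 : k ≠ 0 := right_ne_zero_of_mul hm0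
  rw [ArithmeticFunction.cardFactors_mul hd0 hk0] at hΩ
  have hk : Ω k = 0 := by omega
  rcases ArithmeticFunction.cardFactors_eq_zero_iff_eq_zero_or_one.1 hk with h | h
  · exact absurd h hk0
  · rw [h, mul_one]

/-- `Ω m = 2`, `m > D`: no proper semiprime divisor `≤ D` (`s₂ = 0`). -/
theorem card_filter_two_divisors_eq_zero {m : ℕ} (hm0 : m ≠ 0) (hΩ : Ω m = 2) {D : ℝ}
    (hD : D < m) : #((Nat.divisors m).filter (fun d : ℕ => Ω d = 2 ∧ (d : ℝ) ≤ D)) = 0 := by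
  rw [Finset.card_eq_zero, Finset.filter_eq_empty_iff]
  rintro d hd ⟨hΩd, hdD⟩
  have := eq_of_dvd_of_cardFactors_eq hm0 (Nat.dvd_of_mem_divisors hd) (hΩd.trans hΩ.symm)
  subst this
  linarith

/-- `Ω m = 2`, squarefree, `m > D²`, `D ≥ 0`: `s₁ = [minFac m ≤ D]`. -/
theorem card_filter_prime_divisors_of_two {m : ℕ} (hm : Squarefree m) (hΩ : Ω m = 2) {D : ℝ}
    (hD0 : 0 ≤ D) (hD : D ^ 2 < m) :
    #((Nat.divisors m).filter (fun d : ℕ => d.Prime ∧ (d : ℝ) ≤ D)) =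
      if (m.minFac : ℝ) ≤ D then 1 else 0 := by
  have hm0 : m ≠ 0 := hm.ne_zero
  have hm1 : m ≠ 1 := by rintro rfl; simp at hΩ
  have hp : m.minFac.Prime := Nat.minFac_prime hm1
  rw [card_filter_prime_divisors_eq m]
  -- every prime factor other than `minFac m` exceeds `D`
  have hbig : ∀ r ∈ m.primeFactors, r ≠ m.minFac → D < (r : ℝ) := by
    intro r hr hne
    obtain ⟨hrp, hrm, -⟩ := Nat.mem_primeFactors.1 hr
    have hle : m.minFac ≤ r := Nat.minFac_le_of_dvd hrp.two_le hrm
    have hcop : Nat.Coprime m.minFac r := (Nat.coprime_primes hp hrp).2 (Ne.symm hne)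
    have hdvd : m.minFac * r ∣ m := Nat.Coprime.mul_dvd_of_dvd_of_dvd hcop (Nat.minFac_dvd m) hrm
    have heq : m.minFac * r = m := by
      refine eq_of_dvd_of_cardFactors_eq hm0 hdvd ?_
      rw [ArithmeticFunction.cardFactors_mul hp.ne_zero hrp.ne_zero,
        ArithmeticFunction.cardFactors_apply_prime hp, ArithmeticFunction.cardFactors_apply_prime hrp, hΩ]
    have hr2 : (m : ℝ) ≤ (r : ℝ) ^ 2 := by
      have : m.minFac * r ≤ r * r := Nat.mul_le_mul_right r hle
      rw [heq] at this
      have := (Nat.cast_le (α := ℝ)).2 this; push_cast at this; nlinarith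
    by_contra hle'
    rw [not_lt] at hle'
    have hr0 : (0 : ℝ) ≤ r := Nat.cast_nonneg r
    nlinarith
  by_cases hpD : (m.minFac : ℝ) ≤ D
  · rw [if_pos hpD]
    have : m.primeFactors.filter (fun p : ℕ => (p : ℝ) ≤ D) = {m.minFac} := by
      ext r
      simp only [Finset.mem_filter, Finset.mem_singleton]
      constructor
      · rintro ⟨hr, hrD⟩
        by_contra hne
        exact absurd hrD (not_le.2 (hbig r hr hne))
      · rintro rfl
        exact ⟨Nat.mem_primeFactors.2 ⟨hp, Nat.minFac_dvd m, hm0⟩, hpD⟩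
    rw [this, Finset.card_singleton]
  · rw [if_neg hpD, Finset.card_eq_zero, Finset.filter_eq_empty_iff]
    intro r hr hrD
    by_cases hne : r = m.minFac
    · rw [hne] at hrD; exact hpD hrD
    · exact absurd hrD (not_le.2 (hbig r hr hne))

/-- Squarefree `m`: the number of semiprime divisors is at most `C(Ω m, 2)`. -/
theorem card_filter_two_divisors_le_choose {m : ℕ} (hm : Squarefree m) :
    #((Nat.divisors m).filter (fun d : ℕ => Ω d = 2)) ≤ (Ω m).choose 2 := by
  rw [← card_primeFactors_eq_cardFactors hm, ← Finset.card_powersetCard]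
  refine Finset.card_le_card_of_injOn (fun d => d.primeFactors) ?_ ?_
  · intro d hd
    rw [Finset.mem_coe, Finset.mem_filter] at hd
    have hdm := Nat.dvd_of_mem_divisors hd.1
    have hsq : Squarefree d := hm.squarefree_of_dvd hdm
    rw [Finset.mem_coe, Finset.mem_powersetCard]
    exact ⟨Nat.primeFactors_mono hdm hm.ne_zero, by rw [card_primeFactors_eq_cardFactors hsq, hd.2]⟩
  · intro d₁ hd₁ d₂ hd₂ h
    rw [Finset.mem_coe, Finset.mem_filter] at hd₁ hd₂
    have h1 := Nat.prod_primeFactors_of_squarefree (hm.squarefree_of_dvd (Nat.dvd_of_mem_divisors hd₁.1))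
    have h2 := Nat.prod_primeFactors_of_squarefree (hm.squarefree_of_dvd (Nat.dvd_of_mem_divisors hd₂.1))
    rw [← h1, ← h2]
    simp only at h
    rw [h]

/-- Squarefree `m`, `Ω m = 4`, `m > D²`, `D ≥ 0`: at most three semiprime divisors are `≤ D`
(the involution `d ↦ m/d` maps those `≤ D` injectively into those `> D`, of six in all). -/
theorem card_filter_two_divisors_le_three {m : ℕ} (hm : Squarefree m) (hΩ : Ω m = 4) {D : ℝ}
    (hD0 : 0 ≤ D) (hD : D ^ 2 < m) :
    #((Nat.divisors m).filter (fun d : ℕ => Ω d = 2 ∧ (d : ℝ) ≤ D)) ≤ 3 := by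
  have hm0 : m ≠ 0 := hm.ne_zero
  set A := (Nat.divisors m).filter (fun d : ℕ => Ω d = 2) with hA
  set Ale := (Nat.divisors m).filter (fun d : ℕ => Ω d = 2 ∧ (d : ℝ) ≤ D) with hAle
  set Agt := (Nat.divisors m).filter (fun d : ℕ => Ω d = 2 ∧ D < (d : ℝ)) with hAgt
  have htot : #A ≤ 6 := by
    have := card_filter_two_divisors_le_choose hm; rw [hΩ] at this; exact this
  have hsplit : #Ale + #Agt = #A := by
    rw [hAle, hAgt, hA, ← Finset.filter_filter, ← Finset.filter_filter]
    have := Finset.card_filter_add_card_filter_not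
      (s := (Nat.divisors m).filter (fun d : ℕ => Ω d = 2)) (fun d : ℕ => (d : ℝ) ≤ D)
    simp only [not_le] at this
    exact this
  -- the injection `d ↦ m / d` from `Ale` into `Agt`
  have hinj : #Ale ≤ #Agt := by
    refine Finset.card_le_card_of_injOn (fun d => m / d) ?_ ?_
    · intro d hd
      rw [Finset.mem_coe, hAle, Finset.mem_filter] at hd
      obtain ⟨hdiv, hΩd, hdD⟩ := hd
      have hdm := Nat.dvd_of_mem_divisors hdiv
      have hd0 : d ≠ 0 := (Nat.pos_of_mem_divisors hdiv).ne'
      obtain ⟨k, hk⟩ := hdm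
      have hk0 : k ≠ 0 := by rintro rfl; simp at hk; exact hm0 hk
      have hmk : m / d = k := by rw [hk, Nat.mul_div_cancel_left k (Nat.pos_of_ne_zero hd0)]
      simp only [Finset.mem_coe, hAgt, Finset.mem_filter, hmk]
      refine ⟨Nat.mem_divisors.2 ⟨⟨d, by rw [hk, mul_comm]⟩, hm0⟩, ?_, ?_⟩
      · have := ArithmeticFunction.cardFactors_mul hd0 hk0
        rw [← hk, hΩ, hΩd] at this; omega
      · -- `d k = m > D²`, `d ≤ D` ⇒ `k > D`
        have hcast : (d : ℝ) * k = m := by rw [hk]; push_cast; ring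
        by_contra hle
        rw [not_lt] at hle
        have hd0' : (0 : ℝ) ≤ d := Nat.cast_nonneg d
        have hk0' : (0 : ℝ) ≤ k := Nat.cast_nonneg k
        nlinarith [mul_le_mul hdD hle hk0' hD0]
    · intro d₁ hd₁ d₂ hd₂ h
      rw [Finset.mem_coe, hAle, Finset.mem_filter] at hd₁ hd₂
      have h1 := Nat.dvd_of_mem_divisors hd₁.1
      have h2 := Nat.dvd_of_mem_divisors hd₂.1
      simp only at h
      have := Nat.div_div_self h1 hm0
      rw [h, Nat.div_div_self h2 hm0] at this
      exact this.symm
  omega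

/-- Squarefree `m` with `Ω m = 5`: at least four semiprime divisors (`minFac m · q`). -/
theorem four_le_card_filter_two_divisors {m : ℕ} (hm : Squarefree m) (hΩ : Ω m = 5) :
    4 ≤ #((Nat.divisors m).filter (fun d : ℕ => Ω d = 2)) := by
  have hm0 : m ≠ 0 := hm.ne_zero
  have hm1 : m ≠ 1 := by rintro rfl; simp at hΩ
  have hp : m.minFac.Prime := Nat.minFac_prime hm1
  have hcard : #(m.primeFactors.erase m.minFac) = 4 := by
    rw [Finset.card_erase_of_mem (Nat.mem_primeFactors.2 ⟨hp, Nat.minFac_dvd m, hm0⟩),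
      card_primeFactors_eq_cardFactors hm, hΩ]
  rw [← hcard]
  refine Finset.card_le_card_of_injOn (fun q => m.minFac * q) ?_ ?_
  · intro q hq
    rw [Finset.mem_coe, Finset.mem_erase] at hq
    obtain ⟨hne, hq⟩ := hq
    obtain ⟨hqp, hqm, -⟩ := Nat.mem_primeFactors.1 hq
    have hcop : Nat.Coprime m.minFac q := (Nat.coprime_primes hp hqp).2 (Ne.symm hne)
    rw [Finset.mem_coe, Finset.mem_filter]
    refine ⟨Nat.mem_divisors.2 ⟨Nat.Coprime.mul_dvd_of_dvd_of_dvd hcop (Nat.minFac_dvd m) hqm, hm0⟩, ?_⟩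
    rw [ArithmeticFunction.cardFactors_mul hp.ne_zero hqp.ne_zero,
      ArithmeticFunction.cardFactors_apply_prime hp, ArithmeticFunction.cardFactors_apply_prime hqp]
  · intro q₁ _ q₂ _ h
    simp only at h
    exact Nat.eq_of_mul_eq_mul_left hp.pos h

end Summit.Parity.GeneralizedHardyLittlewood.Theorems.ParityLeakOneFifth
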